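import Literature.NumberTheory.LFunctions.CentralValueForcedZeros
import Literature.NumberTheory.LFunctions.GL2HarmonicFamily
import HarnessLib

/-!
# One vocabulary of record: `IwaniecSarnak.centralValue = GL2Family.centralValue` (PROVED bridge)

Topic `Literature/NumberTheory/LFunctions`. PROOF LAYER, ZERO named facts (D-0026). The cell
`landau-siegel` (LS programme F-S3) landed two carriers for the central value `L(½, f)` of a cusp
form `f ∈ S_k(Γ₀(N))` within minutes of each other (cell INBOX 2026-08-26T17:17:52Z, "RACE"):

* `IwaniecSarnak.centralValue f` (`FamilyNonvanishingLandauSiegel.lean`, p456172): the value at the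
  classical centre `s = k/2` of the ENTIRE CONTINUATION `entireLSeries (cuspCoeff f) (k/2+1)` of the
  Dirichlet series `L(f,s) = Σ a_f(n) n^{−s}` (unique continuation, Diamond–Shurman Thm. 5.10.2);
* `GL2Family.centralValue f` (`GL2HarmonicFamily.lean`, p456881): the value at `s = k/2` of the
  MELLIN expression `L^*(f,s) = (2π)^s Γ(s)⁻¹ ∫₀^∞ f(iy) y^{s−1} dy` (Hecke; Iwaniec–Kowalski §14.6).

This file proves they are EQUAL — indeed `entireLSeries (cuspCoeff f) (k/2+1) = GL2Family.cuspFormLStar f`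
as functions on all of `ℂ` (weight `k ≥ −2`, every level `N ≥ 1`), and hence the central values and
the quadratic-twisted central values agree. Ingredients, all PROVED in the tree: Hecke's candidate
`Λ(s) = N^{s/2} ∫₀^∞ f(it)t^{s−1}dt` is an entire continuation of `Λ_N(f,s)`
(`cpow_mul_mellin_mem_completedCuspFormLContinuations`, from `differentiable_mellin_imagAxis` — the
exponential decay of `f(iy)` at `0⁺` and `∞`), uniqueness of continuations, and the everywhere
identity `Λ(s)Γ(s)⁻¹ = N^{s/2}(2π)^{−s}L(f,s)` (`IwaniecSarnak.completedContinuation_mul_inv_Gamma`).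
Source of the mathematics: Iwaniec, *Conversations*, §4 (4.4) [IwaniecConversations2006] /
Iwaniec–Kowalski §14.6; nothing new is claimed.

Consequence for the cell (ls-Bfam-typer-2's resolution 17:17:52Z made kernel-checked): statements
typed over either carrier are interchangeable by `rw [IwaniecSarnak.centralValue_eq_gl2Family]`
(the weights were already bridged: `harmonicWeight_eq`, `ofReal_harmonicSum` in
`KowalskiMichelHarmonicMoments.lean`); no seat needs to re-type anything. «The programme SEARCHES and TYPES; no claim about Landau–Siegel
zeros, Theorems 1–2 of arXiv:2211.02515 or a repaired Margin232 until a kernel theorem says so.»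
-/

noncomputable section

open scoped MatrixGroups
open CongruenceSubgroup Complex
open Literature.NumberTheory.EllipticCurves.ModularForms

namespace Literature.NumberTheory.LFunctions

namespace IwaniecSarnak

variable {N : ℕ} [NeZero N] {k : ℤ}

/-- **The entire continuation of `L(f,s)` IS Hecke's Mellin expression**: for `f ∈ S_k(Γ₀(N))`,
`k ≥ −2`, and every `s ∈ ℂ`, `entireLSeries (cuspCoeff f) (k/2+1) s = (2π)^s Γ(s)⁻¹ ∫₀^∞ f(iy)y^{s−1}dy`
(`= GL2Family.cuspFormLStar f s`). At the poles of `Γ` both sides are `0` (the trivial zeros of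
`L(f,s)`; Lean's `x / 0 = 0`). [cite: IwaniecConversations2006, §4 (4.4)] -/
theorem entireLSeries_cuspCoeff_eq_cuspFormLStar (hk : -2 ≤ k) (f : CuspForm (Gamma0 N) k) (s : ℂ) :
    entireLSeries (cuspCoeff f) ((k : ℝ) / 2 + 1) s = GL2Family.cuspFormLStar f s := by
  have hN : (N : ℂ) ≠ 0 := Nat.cast_ne_zero.mpr (NeZero.ne N)
  have hπ : (2 * Real.pi : ℂ) ≠ 0 := by exact_mod_cast (mul_pos two_pos Real.pi_pos).ne'
  have hA : (N : ℂ) ^ (s / 2) ≠ 0 := fun h => hN ((cpow_eq_zero_iff _ _).mp h).1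
  have hP : (2 * Real.pi : ℂ) ^ s ≠ 0 := fun h => hπ ((cpow_eq_zero_iff _ _).mp h).1
  have h := completedContinuation_mul_inv_Gamma f
    (cpow_mul_mellin_mem_completedCuspFormLContinuations hk f) s
  -- `h : N^{s/2} · 𝓜(s) · Γ(s)⁻¹ = N^{s/2} · (2π)^{−s} · E(s)`
  rw [GL2Family.cuspFormLStar_def, GL2Family.cuspFormMellin_def]
  rw [mul_assoc, mul_assoc] at h
  have h' := mul_left_cancel₀ hA h
  -- `h' : 𝓜(s) · Γ(s)⁻¹ = (2π)^{−s} · E(s)`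
  rw [cpow_neg] at h'
  calc entireLSeries (cuspCoeff f) ((k : ℝ) / 2 + 1) s
      = (2 * Real.pi : ℂ) ^ s * (((2 * Real.pi : ℂ) ^ s)⁻¹ *
          entireLSeries (cuspCoeff f) ((k : ℝ) / 2 + 1) s) := by
        rw [← mul_assoc, mul_inv_cancel₀ hP, one_mul]
    _ = (2 * Real.pi : ℂ) ^ s / Complex.Gamma s *
          mellin (fun t : ℝ ↦ f (UpperHalfPlane.ofComplex (Complex.I * (t : ℂ)))) s := by
        rw [← h', div_eq_mul_inv]; ring

/-- **`IwaniecSarnak.centralValue f = GL2Family.centralValue f`** (`k ≥ −2`; all weights that carry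
cusp forms). [cite: IwaniecConversations2006, §4 (4.4)] -/
theorem centralValue_eq_gl2Family (hk : -2 ≤ k) (f : CuspForm (Gamma0 N) k) :
    centralValue f = GL2Family.centralValue f := by
  rw [centralValue, GL2Family.centralValue_def]
  exact entireLSeries_cuspCoeff_eq_cuspFormLStar hk f _

/-- **`IwaniecSarnak.twistedCentralValue f ψ = GL2Family.twistedCentralValue f ψ`** for a primitive
QUADRATIC `ψ mod m` (the case of the Landau–Siegel designs, `ψ = χ_D`), any level `N` and `k ≥ −2`:
both equal the central value of the twisted form `f_ψ ∈ S_k(Γ₀(Nm²))`.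
[cite: IwaniecConversations2006, §4 (4.6)–(4.7)] -/
theorem twistedCentralValue_eq_gl2Family (hk : -2 ≤ k) {m : ℕ} [NeZero m]
    {ψ : DirichletCharacter ℂ m} (hψ : ψ.IsQuadratic) (hprim : ψ.IsPrimitive)
    (f : CuspForm (Gamma0 N) k) :
    twistedCentralValue f ψ = GL2Family.twistedCentralValue f ψ := by
  haveI : NeZero (N * m ^ 2) := ⟨mul_ne_zero (NeZero.ne N) (pow_ne_zero 2 (NeZero.ne m))⟩
  rw [twistedCentralValue_eq_centralValue_charTwist (dvd_mul_right N (m ^ 2)) (dvd_mul_left (m ^ 2) N)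
      hψ hprim f, GL2Family.twistedCentralValue_eq_centralValue_charTwist hψ hprim f]
  exact centralValue_eq_gl2Family hk _

end IwaniecSarnak

end Literature.NumberTheory.LFunctions
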